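import Summits.QuantumFields.GaugeBoot.BootstrapAxisPermutations
import Summits.QuantumFields.GaugeBoot.BootstrapWordTruncation
import Literature.MathematicalPhysics.QuantumFieldTheory.SpeciesTimeReflection
import HarnessLib

/-!
# Lattice symmetries of the bootstrap III: every solution is symmetric; symmetric truncations are valid relaxations (gauge-boot, L1 supplement)

HONEST FRAMING (cell `pub-gaugeboot`, page 1 of every file): the venture produces certified bounds
on lattice expectations at stated coupling, gauge group, dimension and torus size; NOT a mass gap,
NOT a continuum limit, NOT a string tension; NOT Yang–Mills-summit-bearing (barriers
`FixedCouplingUltralocality`, `PerturbativeInvisibility`). Structural; it certifies no number.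

## Content

A practical lattice bootstrap identifies Wilson loops related by a lattice symmetry (translations,
axis permutations, reflections — the hyperoctahedral group `B_d ⋉ (ℤ/L)^d`) and by gauge
transformations. Two soundness statements, for `SU(N)` / `U(N)` on the torus at every real `β`:

* ★★★ `bootstrap_invariant_suN` / `_uN` — EVERY solution of the untruncated bootstrap
  (`φ 1 = 1`, square-positivity, all loop equations) is AUTOMATICALLY invariant, on the polynomial
  observables, under every continuous self-map `R` of the configurations which preserves the Wilson
  measure and the polynomials: `φ (f ∘ R) = φ f` (uniqueness `eq_wilson_of_bootstrap_suN`);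
  instances `bootstrap_translationInvariant_suN`, `bootstrap_permInvariant_suN`,
  `bootstrap_reflectionInvariant_suN` (the tree's site reflection `Θ' = GaugeConfig.negReflect`,
  here `negReflectCM`, which REVERSES the links along axis `0`; polynomial stability
  `comp_negReflectCM_mem_polyAlgebra` uses unitarity `ρ(g⁻¹) = ρ(g)ᴴ`), and
  `bootstrap_gaugeInvariant_suN` — the solution is gauge invariant, `φ ∘ A = φ` on polynomials
  (`apply_gaugeAvgL_of_bootstrap_suN`): the all-polynomial bootstrap is determined by its
  gauge-invariant data;
* `symLevelValuesSuN N β n 𝓡 P` — the values of `P` feasible at word level `n` when, in addition,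
  invariance `φ (v ∘ R) = φ v` under a set `𝓡` of such maps is IMPOSED on the level-`n` test
  functions (the symmetry-reduced SDP); ★★ `wilson_mem_symLevelValues_suN` (the Wilson value stays
  feasible whenever every `R ∈ 𝓡` preserves the Wilson measure — `latticeSymmetry_preserves_wilson`
  for translations, axis permutations and the reflection), `symLevelValues_subset_levelValues`,
  ★★★ `symLevelValues_subset_Icc_suN` (the symmetry-reduced bounds contain the Wilson value and
  converge to it: `levelValues_subset_Icc_suN`).

What this is NOT: a reduction of the ROWS under reflections (orientation-reversing maps turn a left
one-link shift into a right shift — sequel); rates; `L → ∞`.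

References: P. Anderson, M. Kruczenski, Nucl. Phys. B 921 (2017) §3; V. Kazakov, Z. Zheng,
arXiv:2203.11360 §3.2. Folklore.
-/

noncomputable section

open MeasureTheory Filter Topology NormedSpace
open scoped Matrix
open Literature.MathematicalPhysics.QuantumFieldTheory (haarProbability LatticeRep Site Edge GaugeConfig
  gaugeTransform IsGaugeInvariant wilsonAction wilsonMeasure edgePerm sitePerm
  isProbabilityMeasure_wilsonMeasure integral_comp_negReflect_eq wilsonMeasure_map_gaugeTransform_holds)

namespace Summit.QuantumFields.GaugeBoot

/-! ## The site reflection as a continuous self-map; polynomial stability -/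

section Reflection

variable {d L : ℕ} {G : Type*} [Group G] [TopologicalSpace G] [IsTopologicalGroup G]

/-- **The site reflection `Θ'`** (`x₀ ↦ -x₀`; spatial links carried along, the links along axis `0`
REVERSED, whence inverted: tree `GaugeConfig.negReflect`) as a continuous self-map of the
configurations. [folklore] -/
def negReflectCM [NeZero d] : C(GaugeConfig d L G, GaugeConfig d L G) where
  toFun := GaugeConfig.negReflect
  continuous_toFun := by
    refine continuous_pi fun e => ?_
    by_cases h : e.2 = 0
    · simp only [GaugeConfig.negReflect, h, if_true]
      exact (continuous_apply _).inv
    · simp only [GaugeConfig.negReflect, h, if_false]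
      exact continuous_apply _

/-- `negReflectCM` is the tree's `GaugeConfig.negReflect`. -/
@[simp] theorem negReflectCM_apply [NeZero d] (U : GaugeConfig d L G) : negReflectCM U = U.negReflect := rfl

variable (r : LatticeRep G)

omit [IsTopologicalGroup G] in
/-- Unitarity: `ρ(g⁻¹) = ρ(g)ᴴ` entrywise — `Re ρ(g⁻¹)_{ab} = Re ρ(g)_{ba}`, `Im ρ(g⁻¹)_{ab} = -Im ρ(g)_{ba}`. -/
theorem rho_inv_apply_re_im (g : G) (a b : Fin r.N) :
    (r.ρ g⁻¹ a b).re = (r.ρ g b a).re ∧ (r.ρ g⁻¹ a b).im = -(r.ρ g b a).im := by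
  have hinv : r.ρ g⁻¹ = (r.ρ g)ᴴ := by
    have h1 : r.ρ g⁻¹ * r.ρ g = 1 := by rw [← map_mul, inv_mul_cancel, map_one]
    have h2 : (r.ρ g)ᴴ * r.ρ g = 1 := by
      have := Matrix.mem_unitaryGroup_iff'.1 (r.mem_unitary g)
      rwa [Matrix.star_eq_conjTranspose] at this
    rw [← Matrix.inv_eq_left_inv h1, Matrix.inv_eq_left_inv h2]
  rw [hinv, Matrix.conjTranspose_apply, Complex.star_def, Complex.conj_re, Complex.conj_im]
  exact ⟨rfl, rfl⟩

/-- **The polynomial observables are stable under the reflection** (a reversed link contributes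
`ρ(U_e⁻¹) = ρ(U_e)ᴴ`, whose entries are ± entries of `ρ(U_e)`). [folklore] -/
theorem comp_negReflectCM_mem_polyAlgebra [NeZero d] {f : C(GaugeConfig d L G, ℝ)}
    (hf : f ∈ polyAlgebra (ι := Edge d L) r) :
    f.comp negReflectCM ∈ polyAlgebra (ι := Edge d L) r := by
  have h : polyAlgebra (ι := Edge d L) r ≤ (polyAlgebra (ι := Edge d L) r).comap
      (ContinuousMap.compRightAlgHom ℝ ℝ (negReflectCM (G := G) (d := d) (L := L))) := by
    refine Algebra.adjoin_le ?_
    rintro _ (⟨⟨e, a, b⟩, rfl⟩ | ⟨⟨e, a, b⟩, rfl⟩)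
    · change (reEntry r e a b).comp negReflectCM ∈ polyAlgebra (ι := Edge d L) r
      by_cases he : e.2 = 0
      · have : (reEntry r e a b).comp (negReflectCM (G := G)) =
            reEntry r (((e.1.shift 0).negReflect, 0) : Edge d L) b a := by
          ext U
          simp only [ContinuousMap.comp_apply, negReflectCM_apply, reEntry_apply, GaugeConfig.negReflect, he,
            if_true]
          exact (rho_inv_apply_re_im r _ a b).1
        rw [this]
        exact reEntry_mem r _ b a
      · have : (reEntry r e a b).comp (negReflectCM (G := G)) = reEntry r ((e.1.negReflect, e.2) : Edge d L) a b := by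
          ext U
          simp only [ContinuousMap.comp_apply, negReflectCM_apply, reEntry_apply, GaugeConfig.negReflect, he,
            if_false]
        rw [this]
        exact reEntry_mem r _ a b
    · change (imEntry r e a b).comp negReflectCM ∈ polyAlgebra (ι := Edge d L) r
      by_cases he : e.2 = 0
      · have : (imEntry r e a b).comp (negReflectCM (G := G)) =
            -imEntry r (((e.1.shift 0).negReflect, 0) : Edge d L) b a := by
          ext U
          simp only [ContinuousMap.comp_apply, negReflectCM_apply, imEntry_apply, GaugeConfig.negReflect, he,
            if_true, ContinuousMap.neg_apply]
          exact (rho_inv_apply_re_im r _ a b).2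
        rw [this]
        exact Subalgebra.neg_mem _ (imEntry_mem r _ b a)
      · have : (imEntry r e a b).comp (negReflectCM (G := G)) = imEntry r ((e.1.negReflect, e.2) : Edge d L) a b := by
          ext U
          simp only [ContinuousMap.comp_apply, negReflectCM_apply, imEntry_apply, GaugeConfig.negReflect, he,
            if_false]
        rw [this]
        exact imEntry_mem r _ a b
  exact h hf

variable {N : ℕ} (ρ : G →* Matrix (Fin N) (Fin N) ℂ) [CompactSpace G] [MeasurableSpace G] [BorelSpace G]

/-- **The Wilson expectations are reflection invariant** (every observable, every side `L`; tree
`integral_comp_negReflect_eq`, Osterwalder–Seiler). -/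
theorem integral_comp_negReflectCM_eq_wilson [NeZero d] [NeZero L] (hρ : Continuous ρ) (β : ℝ)
    (f : C(GaugeConfig d L G, ℝ)) :
    ∫ U, f (negReflectCM U) ∂(wilsonMeasure ρ β) = ∫ U, f U ∂(wilsonMeasure (d := d) (L := L) ρ β) :=
  integral_comp_negReflect_eq ρ hρ β f

omit [CompactSpace G] [MeasurableSpace G] [BorelSpace G] in
/-- **The polynomial observables are stable under gauge transformations** (a link variable
transforms linearly, `U_e ↦ γ_x U_e γ_y⁻¹`; `gaugeTransform_hgen`, `exists_fg_invariant_of_mem_polyAlgebra`). -/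
theorem comp_gaugeTransformCM_mem_polyAlgebra (γ : Site d L → G) {f : C(GaugeConfig d L G, ℝ)}
    (hf : f ∈ polyAlgebra (ι := Edge d L) r) :
    f.comp (gaugeTransformCM d L G γ) ∈ polyAlgebra (ι := Edge d L) r := by
  obtain ⟨W, -, hWle, hfW, hWinv⟩ :=
    exists_fg_invariant_of_mem_polyAlgebra r gaugeTransform_action.2 (gaugeTransform_hgen r) hf
  exact hWle (hWinv γ (Submodule.mem_map_of_mem hfW))

/-- **The Wilson expectations are gauge invariant** (tree `wilsonMeasure_map_gaugeTransform_holds`). -/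
theorem integral_comp_gaugeTransformCM_eq_wilson [SecondCountableTopology G] [NeZero L] (β : ℝ) (γ : Site d L → G)
    (f : C(GaugeConfig d L G, ℝ)) :
    ∫ U, f (gaugeTransformCM d L G γ U) ∂(wilsonMeasure ρ β) = ∫ U, f U ∂(wilsonMeasure (d := d) (L := L) ρ β) := by
  have hmeas : Measurable (gaugeTransform (d := d) (L := L) (G := G) γ) :=
    (gaugeTransformCM d L G γ).continuous.measurable
  have h := integral_map (μ := wilsonMeasure (d := d) (L := L) ρ β) hmeas.aemeasurable
    (f.continuous.aestronglyMeasurable (μ := (wilsonMeasure (d := d) (L := L) ρ β).map (gaugeTransform γ)))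
  rw [wilsonMeasure_map_gaugeTransform_holds ρ β γ] at h
  simpa only [gaugeTransformCM_apply] using h.symm

omit [IsTopologicalGroup G] [CompactSpace G] [BorelSpace G] in
/-- **The Wilson expectations are translation invariant** (every observable; tree
`wilsonExpectation_comp_torusConfigShift`: `relabelCM (translateEquiv a) = torusConfigShift (-a)`). -/
theorem integral_comp_translateEquiv_eq_wilson [IsTopologicalGroup G] [CompactSpace G] [BorelSpace G] [NeZero L]
    (β : ℝ) (a : Site d L) (f : C(GaugeConfig d L G, ℝ)) :
    ∫ U, f (relabelCM (translateEquiv a) U) ∂(wilsonMeasure ρ β) = ∫ U, f U ∂(wilsonMeasure (d := d) (L := L) ρ β) := by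
  have h := Literature.MathematicalPhysics.QuantumFieldTheory.wilsonExpectation_comp_torusConfigShift
    (d := d) (L := L) ρ β (-a) f
  have hR : ∀ U : GaugeConfig d L G, Literature.MathematicalPhysics.QuantumFieldTheory.torusConfigShift (-a) U =
      relabelCM (G := G) (translateEquiv a) U := fun U => by
    funext e
    rw [Literature.MathematicalPhysics.QuantumFieldTheory.torusConfigShift_apply, relabelCM_apply,
      translateEquiv_apply, sub_neg_eq_add]
  simp only [Literature.MathematicalPhysics.QuantumFieldTheory.wilsonExpectation, Function.comp_apply, hR] at h
  exact h

end Reflection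

/-! ## Every solution of the bootstrap is symmetric -/

section Unitary

open Literature.MathematicalPhysics.QuantumLattice

variable {d L : ℕ}

/-- ★★★ **`SU(N)` on `(ℤ/L)^d`, ANY real `β`: every solution of the untruncated bootstrap is
invariant under every polynomial-stable symmetry of the Wilson measure.** If `R` is a continuous
self-map of the configurations preserving the Wilson measure (`∫ f ∘ R = ∫ f`) and the polynomial
observables, then `φ (f ∘ R) = φ f` for every polynomial `f` and every normalised, square-positive
`φ` satisfying the loop equations. [folklore] -/
theorem bootstrap_invariant_suN [NeZero L] (N : ℕ) (β : ℝ)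
    {φ : C(GaugeConfig d L (Matrix.specialUnitaryGroup (Fin N) ℂ), ℝ) →ₗ[ℝ] ℝ} (h1 : φ 1 = 1)
    (hpos : ∀ a ∈ polyAlgebra (ι := Edge d L) (fundamentalLatticeRep N), 0 ≤ φ (a * a))
    (hφ : IsSDFunctional (fundamentalLatticeRep N) (suExp N)
      (fun _ => wilsonAction (fundamentalRep (Fin N))) β φ)
    (R : C(GaugeConfig d L (Matrix.specialUnitaryGroup (Fin N) ℂ), GaugeConfig d L (Matrix.specialUnitaryGroup (Fin N) ℂ)))
    (hR : ∀ f : C(GaugeConfig d L (Matrix.specialUnitaryGroup (Fin N) ℂ), ℝ),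
      ∫ U, f (R U) ∂(wilsonMeasure (fundamentalRep (Fin N)) β) =
        ∫ U, f U ∂(wilsonMeasure (d := d) (L := L) (fundamentalRep (Fin N)) β))
    (hRpoly : ∀ g ∈ polyAlgebra (ι := Edge d L) (fundamentalLatticeRep N),
      g.comp R ∈ polyAlgebra (ι := Edge d L) (fundamentalLatticeRep N))
    {f : C(GaugeConfig d L (Matrix.specialUnitaryGroup (Fin N) ℂ), ℝ)}
    (hf : f ∈ polyAlgebra (ι := Edge d L) (fundamentalLatticeRep N)) :
    φ (f.comp R) = φ f := by
  rw [eq_wilson_of_bootstrap_suN N β h1 hpos hφ (hRpoly f hf), eq_wilson_of_bootstrap_suN N β h1 hpos hφ hf]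
  exact hR f

/-- ★★★ **`U(N)`: every solution of the untruncated bootstrap is invariant under every
polynomial-stable symmetry of the Wilson measure.** [folklore] -/
theorem bootstrap_invariant_uN [NeZero L] (N : ℕ) (β : ℝ)
    {φ : C(GaugeConfig d L (Matrix.unitaryGroup (Fin N) ℂ), ℝ) →ₗ[ℝ] ℝ} (h1 : φ 1 = 1)
    (hpos : ∀ a ∈ polyAlgebra (ι := Edge d L) (unitaryFundamentalLatticeRep N), 0 ≤ φ (a * a))
    (hφ : IsSDFunctional (unitaryFundamentalLatticeRep N) (uExp N)
      (fun _ => wilsonAction (unitaryFundamentalRep (Fin N) ℂ)) β φ)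
    (R : C(GaugeConfig d L (Matrix.unitaryGroup (Fin N) ℂ), GaugeConfig d L (Matrix.unitaryGroup (Fin N) ℂ)))
    (hR : ∀ f : C(GaugeConfig d L (Matrix.unitaryGroup (Fin N) ℂ), ℝ),
      ∫ U, f (R U) ∂(wilsonMeasure (unitaryFundamentalRep (Fin N) ℂ) β) =
        ∫ U, f U ∂(wilsonMeasure (d := d) (L := L) (unitaryFundamentalRep (Fin N) ℂ) β))
    (hRpoly : ∀ g ∈ polyAlgebra (ι := Edge d L) (unitaryFundamentalLatticeRep N),
      g.comp R ∈ polyAlgebra (ι := Edge d L) (unitaryFundamentalLatticeRep N))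
    {f : C(GaugeConfig d L (Matrix.unitaryGroup (Fin N) ℂ), ℝ)}
    (hf : f ∈ polyAlgebra (ι := Edge d L) (unitaryFundamentalLatticeRep N)) :
    φ (f.comp R) = φ f := by
  rw [eq_wilson_of_bootstrap_uN N β h1 hpos hφ (hRpoly f hf), eq_wilson_of_bootstrap_uN N β h1 hpos hφ hf]
  exact hR f

variable [NeZero L] (N : ℕ) (β : ℝ)
  {φ : C(GaugeConfig d L (Matrix.specialUnitaryGroup (Fin N) ℂ), ℝ) →ₗ[ℝ] ℝ}

/-- **Every solution is translation invariant** (`SU(N)`; cf. `integral_comp_translate_eq_wilson_suN`). -/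
theorem bootstrap_translationInvariant_suN (h1 : φ 1 = 1)
    (hpos : ∀ a ∈ polyAlgebra (ι := Edge d L) (fundamentalLatticeRep N), 0 ≤ φ (a * a))
    (hφ : IsSDFunctional (fundamentalLatticeRep N) (suExp N) (fun _ => wilsonAction (fundamentalRep (Fin N))) β φ)
    (a : Site d L) {f : C(GaugeConfig d L (Matrix.specialUnitaryGroup (Fin N) ℂ), ℝ)}
    (hf : f ∈ polyAlgebra (ι := Edge d L) (fundamentalLatticeRep N)) :
    φ (f.comp (relabelCM (translateEquiv a))) = φ f :=
  bootstrap_invariant_suN N β h1 hpos hφ _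
    (fun g => integral_comp_translateEquiv_eq_wilson (fundamentalRep (Fin N)) β a g)
    (fun _ hg => comp_relabelCM_mem_polyAlgebra _ _ hg) hf

/-- **Every solution is invariant under the axis permutations** (`SU(N)`). -/
theorem bootstrap_permInvariant_suN (h1 : φ 1 = 1)
    (hpos : ∀ a ∈ polyAlgebra (ι := Edge d L) (fundamentalLatticeRep N), 0 ≤ φ (a * a))
    (hφ : IsSDFunctional (fundamentalLatticeRep N) (suExp N) (fun _ => wilsonAction (fundamentalRep (Fin N))) β φ)
    (σ : Equiv.Perm (Fin d)) {f : C(GaugeConfig d L (Matrix.specialUnitaryGroup (Fin N) ℂ), ℝ)}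
    (hf : f ∈ polyAlgebra (ι := Edge d L) (fundamentalLatticeRep N)) :
    φ (f.comp (relabelCM (edgePerm σ))) = φ f :=
  bootstrap_invariant_suN N β h1 hpos hφ _
    (fun g => integral_comp_edgePerm_eq_wilson (fundamentalRep (Fin N)) (continuous_fundamentalRep _) β σ g)
    (fun _ hg => comp_relabelCM_mem_polyAlgebra _ _ hg) hf

/-- ★★★ **Every solution is REFLECTION invariant** (`SU(N)`, `d ≥ 1`): `φ (f ∘ Θ') = φ f` for the site
reflection `x₀ ↦ -x₀` (links along axis `0` reversed). Together with the translations and the axis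
permutations: the full lattice symmetry group `B_d ⋉ (ℤ/L)^d` acts trivially on every solution.
[folklore] -/
theorem bootstrap_reflectionInvariant_suN [NeZero d] (h1 : φ 1 = 1)
    (hpos : ∀ a ∈ polyAlgebra (ι := Edge d L) (fundamentalLatticeRep N), 0 ≤ φ (a * a))
    (hφ : IsSDFunctional (fundamentalLatticeRep N) (suExp N) (fun _ => wilsonAction (fundamentalRep (Fin N))) β φ)
    {f : C(GaugeConfig d L (Matrix.specialUnitaryGroup (Fin N) ℂ), ℝ)}
    (hf : f ∈ polyAlgebra (ι := Edge d L) (fundamentalLatticeRep N)) :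
    φ (f.comp negReflectCM) = φ f :=
  bootstrap_invariant_suN N β h1 hpos hφ _
    (fun g => integral_comp_negReflectCM_eq_wilson (fundamentalRep (Fin N)) (continuous_fundamentalRep _) β g)
    (fun _ hg => comp_negReflectCM_mem_polyAlgebra _ hg) hf

/-- ★★★ **Every solution is GAUGE invariant**: `φ (f ∘ (· )^γ) = φ f` for every gauge transformation
`γ : (ℤ/L)^d → SU(N)` and every polynomial `f` — although no gauge invariance was imposed. [folklore] -/
theorem bootstrap_gaugeInvariant_suN (h1 : φ 1 = 1)
    (hpos : ∀ a ∈ polyAlgebra (ι := Edge d L) (fundamentalLatticeRep N), 0 ≤ φ (a * a))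
    (hφ : IsSDFunctional (fundamentalLatticeRep N) (suExp N) (fun _ => wilsonAction (fundamentalRep (Fin N))) β φ)
    (γ : Site d L → Matrix.specialUnitaryGroup (Fin N) ℂ)
    {f : C(GaugeConfig d L (Matrix.specialUnitaryGroup (Fin N) ℂ), ℝ)}
    (hf : f ∈ polyAlgebra (ι := Edge d L) (fundamentalLatticeRep N)) :
    φ (f.comp (gaugeTransformCM d L _ γ)) = φ f :=
  bootstrap_invariant_suN N β h1 hpos hφ _
    (fun g => integral_comp_gaugeTransformCM_eq_wilson (fundamentalRep (Fin N)) β γ g)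
    (fun _ hg => comp_gaugeTransformCM_mem_polyAlgebra _ γ hg) hf

/-- ★★ **Hence every solution is determined by its gauge-invariant data**: `φ (A f) = φ f` for the
gauge average `A` and every polynomial `f` (`apply_gaugeAvgL_of_invariant`). [folklore] -/
theorem apply_gaugeAvgL_of_bootstrap_suN (h1 : φ 1 = 1)
    (hpos : ∀ a ∈ polyAlgebra (ι := Edge d L) (fundamentalLatticeRep N), 0 ≤ φ (a * a))
    (hφ : IsSDFunctional (fundamentalLatticeRep N) (suExp N) (fun _ => wilsonAction (fundamentalRep (Fin N))) β φ)
    {f : C(GaugeConfig d L (Matrix.specialUnitaryGroup (Fin N) ℂ), ℝ)}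
    (hf : f ∈ polyAlgebra (ι := Edge d L) (fundamentalLatticeRep N)) :
    φ (gaugeAvgL d L _ f) = φ f :=
  apply_gaugeAvgL_of_invariant (fundamentalLatticeRep N) φ
    (fun γ _ hg => bootstrap_gaugeInvariant_suN N β h1 hpos hφ γ hg) hf

end Unitary

/-! ## Symmetric truncations are valid relaxations -/

section SymTrunc

open Literature.MathematicalPhysics.QuantumLattice

variable {d L : ℕ} [NeZero L]

/-- **The values of `P` feasible at word level `n` with IMPOSED symmetry**: the level-`n` feasible
functionals (`IsBootstrapFeasible` on `wordTruncation n`: normalisation, PSD moment matrix of the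
words of length `≤ n`, their loop equations) which are moreover invariant, on the level-`n` test
functions, under every map of the family `𝓡` (`φ (v ∘ R) = φ v`) — the symmetry-reduced SDP of
Anderson–Kruczenski / Kazakov–Zheng. (`SU(N)`, torus.) [folklore] -/
def symLevelValuesSuN (N : ℕ) (β : ℝ) (n : ℕ)
    (𝓡 : Set C(GaugeConfig d L (Matrix.specialUnitaryGroup (Fin N) ℂ), GaugeConfig d L (Matrix.specialUnitaryGroup (Fin N) ℂ)))
    (P : C(GaugeConfig d L (Matrix.specialUnitaryGroup (Fin N) ℂ), ℝ)) : Set ℝ :=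
  {t | ∃ φ : C(GaugeConfig d L (Matrix.specialUnitaryGroup (Fin N) ℂ), ℝ) →ₗ[ℝ] ℝ,
    IsBootstrapFeasible (fundamentalLatticeRep N) (suExp N)
        (fun _ => wilsonAction (fundamentalRep (Fin N))) β
        (wordTruncation (ι := Edge d L) (fundamentalLatticeRep N) n) φ ∧
      (∀ R ∈ 𝓡, ∀ v ∈ wordTruncation (ι := Edge d L) (fundamentalLatticeRep N) n, φ (v.comp R) = φ v) ∧
      φ P = t}

/-- Imposing symmetry shrinks the feasible set. -/
theorem symLevelValues_subset_levelValues (N : ℕ) (β : ℝ) (n : ℕ)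
    (𝓡 : Set C(GaugeConfig d L (Matrix.specialUnitaryGroup (Fin N) ℂ), GaugeConfig d L (Matrix.specialUnitaryGroup (Fin N) ℂ)))
    (P : C(GaugeConfig d L (Matrix.specialUnitaryGroup (Fin N) ℂ), ℝ)) :
    symLevelValuesSuN (d := d) (L := L) N β n 𝓡 P ⊆ levelValuesSuN (d := d) (L := L) N β n P := by
  rintro t ⟨φ, hφ, -, rfl⟩
  exact ⟨φ, hφ, rfl⟩

/-- ★★ **The Wilson value stays feasible in the symmetry-reduced SDP** whenever every imposed map
preserves the Wilson measure. [folklore] -/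
theorem wilson_mem_symLevelValues_suN (N : ℕ) (β : ℝ) (n : ℕ)
    {𝓡 : Set C(GaugeConfig d L (Matrix.specialUnitaryGroup (Fin N) ℂ), GaugeConfig d L (Matrix.specialUnitaryGroup (Fin N) ℂ))}
    (h𝓡 : ∀ R ∈ 𝓡, ∀ f : C(GaugeConfig d L (Matrix.specialUnitaryGroup (Fin N) ℂ), ℝ),
      ∫ U, f (R U) ∂(wilsonMeasure (fundamentalRep (Fin N)) β) =
        ∫ U, f U ∂(wilsonMeasure (d := d) (L := L) (fundamentalRep (Fin N)) β))
    (P : C(GaugeConfig d L (Matrix.specialUnitaryGroup (Fin N) ℂ), ℝ)) :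
    ∫ U, P U ∂(wilsonMeasure (fundamentalRep (Fin N)) β) ∈ symLevelValuesSuN (d := d) (L := L) N β n 𝓡 P := by
  haveI : IsProbabilityMeasure (wilsonMeasure (d := d) (L := L) (fundamentalRep (Fin N)) β) :=
    isProbabilityMeasure_wilsonMeasure (ρ := fundamentalRep (Fin N)) (continuous_fundamentalRep _) β
  refine ⟨expectationFunctional (wilsonMeasure (fundamentalRep (Fin N)) β),
    isBootstrapFeasible_wilson_suN N β _ rfl (wordTruncation_subset_polyAlgebra _ n), fun R hR v _ => ?_, rfl⟩
  rw [expectationFunctional_apply, expectationFunctional_apply]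
  exact h𝓡 R hR v

/-- ★★★ **The symmetry-reduced bounds converge to the Wilson value**: for every polynomial `P` and
`ε > 0`, for all large `n` the symmetric level-`n` feasible values — a set containing the Wilson
expectation `W` when `𝓡` preserves the Wilson measure — lie in `[W - ε, W + ε]`. [folklore] -/
theorem symLevelValues_subset_Icc_suN (N : ℕ) (β : ℝ)
    (𝓡 : Set C(GaugeConfig d L (Matrix.specialUnitaryGroup (Fin N) ℂ), GaugeConfig d L (Matrix.specialUnitaryGroup (Fin N) ℂ)))
    {P : C(GaugeConfig d L (Matrix.specialUnitaryGroup (Fin N) ℂ), ℝ)}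
    (hP : P ∈ polyAlgebra (ι := Edge d L) (fundamentalLatticeRep N)) {ε : ℝ} (hε : 0 < ε) :
    ∀ᶠ n in atTop, symLevelValuesSuN (d := d) (L := L) N β n 𝓡 P ⊆
      Set.Icc (∫ U, P U ∂(wilsonMeasure (fundamentalRep (Fin N)) β) - ε)
        (∫ U, P U ∂(wilsonMeasure (fundamentalRep (Fin N)) β) + ε) := by
  filter_upwards [levelValues_subset_Icc_suN N β hP hε] with n hn
  exact (symLevelValues_subset_levelValues N β n 𝓡 P).trans hn

/-- **The lattice symmetries preserve the Wilson measure** (`SU(N)`, `d ≥ 1`): the translations, the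
axis permutations and the site reflection qualify for `wilson_mem_symLevelValues_suN`. [folklore] -/
theorem latticeSymmetry_preserves_wilson_suN [NeZero d] (N : ℕ) (β : ℝ) :
    ∀ R ∈ (Set.range fun a : Site d L => relabelCM (G := Matrix.specialUnitaryGroup (Fin N) ℂ) (translateEquiv a)) ∪
        (Set.range fun σ : Equiv.Perm (Fin d) => relabelCM (G := Matrix.specialUnitaryGroup (Fin N) ℂ) (edgePerm (L := L) σ)) ∪
        {negReflectCM},
      ∀ f : C(GaugeConfig d L (Matrix.specialUnitaryGroup (Fin N) ℂ), ℝ),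
        ∫ U, f (R U) ∂(wilsonMeasure (fundamentalRep (Fin N)) β) =
          ∫ U, f U ∂(wilsonMeasure (d := d) (L := L) (fundamentalRep (Fin N)) β) := by
  rintro R ((⟨a, rfl⟩ | ⟨σ, rfl⟩) | hR) f
  · exact integral_comp_translateEquiv_eq_wilson (fundamentalRep (Fin N)) β a f
  · exact integral_comp_edgePerm_eq_wilson (fundamentalRep (Fin N)) (continuous_fundamentalRep _) β σ f
  · rw [Set.mem_singleton_iff.1 hR]
    exact integral_comp_negReflectCM_eq_wilson (fundamentalRep (Fin N)) (continuous_fundamentalRep _) β f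

/-- ★★★ **Summary (`SU(N)`, `d ≥ 1`, any `β`, any torus): the word-length-`n` SDP with the full
lattice symmetry imposed keeps the Wilson value feasible and its interval shrinks to it.** [folklore] -/
theorem latticeSymmetric_bootstrap_convergence_suN [NeZero d] (N : ℕ) (β : ℝ)
    {P : C(GaugeConfig d L (Matrix.specialUnitaryGroup (Fin N) ℂ), ℝ)}
    (hP : P ∈ polyAlgebra (ι := Edge d L) (fundamentalLatticeRep N)) {ε : ℝ} (hε : 0 < ε) :
    (∀ n, ∫ U, P U ∂(wilsonMeasure (fundamentalRep (Fin N)) β) ∈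
        symLevelValuesSuN (d := d) (L := L) N β n
          ((Set.range fun a : Site d L => relabelCM (G := Matrix.specialUnitaryGroup (Fin N) ℂ) (translateEquiv a)) ∪
            (Set.range fun σ : Equiv.Perm (Fin d) =>
              relabelCM (G := Matrix.specialUnitaryGroup (Fin N) ℂ) (edgePerm (L := L) σ)) ∪
            {negReflectCM}) P) ∧
      ∀ᶠ n in atTop, symLevelValuesSuN (d := d) (L := L) N β n
          ((Set.range fun a : Site d L => relabelCM (G := Matrix.specialUnitaryGroup (Fin N) ℂ) (translateEquiv a)) ∪
            (Set.range fun σ : Equiv.Perm (Fin d) =>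
              relabelCM (G := Matrix.specialUnitaryGroup (Fin N) ℂ) (edgePerm (L := L) σ)) ∪
            {negReflectCM}) P ⊆
        Set.Icc (∫ U, P U ∂(wilsonMeasure (fundamentalRep (Fin N)) β) - ε)
          (∫ U, P U ∂(wilsonMeasure (fundamentalRep (Fin N)) β) + ε) :=
  ⟨fun n => wilson_mem_symLevelValues_suN N β n (latticeSymmetry_preserves_wilson_suN N β) P,
    symLevelValues_subset_Icc_suN N β _ hP hε⟩

end SymTrunc

end Summit.QuantumFields.GaugeBoot

end
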